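import Mathlib.LinearAlgebra.BilinearForm.Orthogonal
import Mathlib.LinearAlgebra.Matrix.BilinearForm
import Mathlib.LinearAlgebra.Matrix.DotProduct
import Mathlib.Data.Complex.Basic
import HarnessLib

/-!
# Double orthogonality: a vector orthogonal to a rational subspace whose twist is orthogonal to the orthogonal complement
# is isotropic (the linear algebra closing the «centre» of the Hodge Lie algebra; Deligne 1982, I §3 Prop. 3.4, Ex. 3.7 (c))

Family `hodge`, layer `Literature/AlgebraicGeometry/Motives`.  THEOREMS ONLY (no definition, no named fact).  Written for the
cell `pub-hodgecm2` (COR-CM), seat `b27` gen 55 (count-neutral Mumford–Tate-rank ladder, «the centre», part 3: the abstract lemma).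

THE LEMMA (`sum_mul_mul_self_eq_zero_of_orthogonal`).  Let `ι` be a finite set, `P ⊆ ℚ^ι` a set of rational vectors,
`m ∈ ℚ^ι`, and `x ∈ L^ι` a vector with coordinates in a field `L ⊇ ℚ`.  Suppose
* (A) `x` is orthogonal to `P`:  `Σᵢ pᵢ xᵢ = 0` for every `p ∈ P`;
* (B) the twisted vector `(mᵢ xᵢ)ᵢ` is orthogonal to the RATIONAL orthogonal complement of `P`:  `Σᵢ qᵢ mᵢ xᵢ = 0` for every
  `q ∈ ℚ^ι` with `Σᵢ qᵢ pᵢ = 0` for all `p ∈ P`.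
Then `Σᵢ mᵢ xᵢ² = 0`.  PROOF: the dot product is positive definite on `ℚ^ι`, so `ℚ^ι = ⟨P⟩ ⊕ ⟨P⟩^⊥` (Mathlib's
`LinearMap.BilinForm.isCompl_orthogonal_of_restrict_nondegenerate`); writing the standard basis vectors as `δⱼ = aⱼ + bⱼ`
(`aⱼ ∈ ⟨P⟩`, `bⱼ ∈ ⟨P⟩^⊥`) splits `x = x_P + x_Q` and `y = (mᵢxᵢ) = y_P + y_Q` over `L`, and
`⟨x, y⟩ = ⟨x, y_P⟩ + ⟨x_P, y_Q⟩ + ⟨x_Q, y_Q⟩ = 0 + 0 + 0` by (A), `⟨P⟩ ⊥ ⟨P⟩^⊥`, and (B).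

USE (part 5, `Motives/HodgeLieRigid`).  For a polarizable Hodge structure and `z` in the centre of its Hodge Lie algebra with
eigenvalues `λ` of multiplicities `m_λ` and `Θ`-traces `μ_λ = tr(Θ|V_λ)`: `P` = the `Aut(ℂ)`-translates of `μ`, `x_λ = λ`;
(A) is `tr(z_ℂ Θ) = 0` and its Galois conjugates, (B) comes from the determinant Hodge tensors (part 4), and the conclusion
`Σ m_λ λ² = tr(z²) = 0` forces `z = 0` — Deligne's «`Y(G)` is the `Gal(ℚ̄/ℚ)`-module generated by `μ`» (LNM 900, I Ex. 3.7 (c),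
Prop. 3.4) for the centre of the Mumford–Tate group of an arbitrary polarizable Hodge structure, in dual form.

## References
* [Deligne1982HodgeCycles] P. Deligne, *Hodge cycles on abelian varieties*, LNM 900 (1982), I §3 Prop. 3.4, Example 3.7 (c).
  [cite: Deligne1982HodgeCycles, I §3 Prop. 3.4 and Example 3.7 (c)]
* [MoonenZarhin1999LowDim] B. Moonen, Yu. G. Zarhin, Math. Ann. 315 (1999), §3 (3.1) [corpus: paper:arxiv-math_9901113 p. 6].
  [cite: MoonenZarhin1999LowDim, §3 (3.1)]
* [SpringerLAG1998] T. A. Springer, *Linear Algebraic Groups*, 2nd ed. (1998), 11.1.4 (rational structures on vector spaces).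
  [cite: SpringerLAG1998, Prop. 11.1.4]
-/

noncomputable section

namespace Literature.AlgebraicGeometry.Motives

universe u v

variable {ι : Type u} [Fintype ι] [DecidableEq ι] {L : Type v} [Field L] [CharZero L]

/-- The rational dot product `⟨u, v⟩ = Σᵢ uᵢ vᵢ` (Mathlib's `Matrix.toBilin' 1`) on pairs. [folklore] -/
private theorem toBilin'_one_apply (u v : ι → ℚ) :
    Matrix.toBilin' (1 : Matrix ι ι ℚ) u v = ∑ i, u i * v i := by
  rw [Matrix.toBilin'_apply', Matrix.one_mulVec]
  rfl

/-- **Double orthogonality.**  `P ⊆ ℚ^ι` rational vectors, `m ∈ ℚ^ι`, `x ∈ L^ι` (`L ⊇ ℚ` a field): if `x ⊥ P` (A) and the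
twisted vector `(mᵢ xᵢ)` is orthogonal to every RATIONAL vector orthogonal to `P` (B), then `Σᵢ mᵢ xᵢ² = 0` — because
`ℚ^ι = ⟨P⟩ ⊕ ⟨P⟩^⊥` for the (positive definite) dot product. [cite: Deligne1982HodgeCycles, I §3 Prop. 3.4 and Example 3.7 (c)]
[cite: SpringerLAG1998, Prop. 11.1.4] -/
theorem sum_mul_mul_self_eq_zero_of_orthogonal (P : Set (ι → ℚ)) (m : ι → ℚ) (x : ι → L)
    (hA : ∀ p ∈ P, ∑ i, (p i : L) * x i = 0)
    (hB : ∀ q : ι → ℚ, (∀ p ∈ P, ∑ i, q i * p i = 0) → ∑ i, (q i : L) * ((m i : L) * x i) = 0) :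
    ∑ i, (m i : L) * (x i * x i) = 0 := by
  classical
  -- the dot product on `ℚ^ι`, `⟨P⟩` and its orthogonal complement
  set B : LinearMap.BilinForm ℚ (ι → ℚ) := Matrix.toBilin' (1 : Matrix ι ι ℚ) with hBdef
  have hBapply : ∀ u v : ι → ℚ, B u v = ∑ i, u i * v i := fun u v => toBilin'_one_apply u v
  set P' : Submodule ℚ (ι → ℚ) := Submodule.span ℚ P with hP'
  set Q : Submodule ℚ (ι → ℚ) := B.orthogonal P' with hQdef
  -- (A) extends to the span; `Q` is described by `P`; `⟨P⟩ ⊥ Q`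
  have hxP : ∀ p ∈ P', ∑ i, (p i : L) * x i = 0 := by
    intro p hp
    induction hp using Submodule.span_induction with
    | mem p hp => exact hA p hp
    | zero => simp
    | add p p' _ _ hp hp' =>
      simp only [Pi.add_apply, Rat.cast_add, add_mul, Finset.sum_add_distrib, hp, hp', add_zero]
    | smul c p _ hp =>
      simp only [Pi.smul_apply, smul_eq_mul, Rat.cast_mul, mul_assoc, ← Finset.mul_sum, hp, mul_zero]
  have hQP : ∀ q ∈ Q, ∀ p ∈ P, ∑ i, q i * p i = 0 := by
    intro q hq p hp
    rw [hQdef, LinearMap.BilinForm.mem_orthogonal_iff] at hq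
    have h := hq p (Submodule.subset_span hp)
    rw [hBapply] at h
    simpa only [mul_comm] using h
  have hPQ : ∀ p ∈ P', ∀ q ∈ Q, ∑ i, p i * q i = 0 := by
    intro p hp q hq
    rw [hQdef, LinearMap.BilinForm.mem_orthogonal_iff] at hq
    have h := hq p hp
    rwa [hBapply] at h
  -- `ℚ^ι = ⟨P⟩ ⊕ Q`: the dot product is positive definite
  have hrefl : B.IsRefl := by
    intro u v h
    rw [hBapply] at h ⊢
    simpa only [mul_comm] using h
  have hdef : ∀ u : ι → ℚ, ∑ i, u i * u i = 0 → u = 0 := fun u hu => dotProduct_self_eq_zero.1 hu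
  have hnd : (B.restrict P').Nondegenerate := by
    constructor
    · intro u hu
      have h : B u.1 u.1 = 0 := hu u
      rw [hBapply] at h
      exact Subtype.ext (hdef u.1 h)
    · intro u hu
      have h : B u.1 u.1 = 0 := hu u
      rw [hBapply] at h
      exact Subtype.ext (hdef u.1 h)
  have hcompl : IsCompl P' Q := LinearMap.BilinForm.isCompl_orthogonal_of_restrict_nondegenerate hrefl hnd
  -- decompose the standard basis vectors: `δ_j = a_j + b_j`
  have hdec : ∀ j : ι, ∃ a ∈ P', ∃ b ∈ Q, (Pi.single j (1 : ℚ) : ι → ℚ) = a + b := by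
    intro j
    have h : (Pi.single j (1 : ℚ) : ι → ℚ) ∈ P' ⊔ Q := by
      rw [hcompl.sup_eq_top]; exact Submodule.mem_top
    obtain ⟨a, ha, b, hb, hab⟩ := Submodule.mem_sup.1 h
    exact ⟨a, ha, b, hb, hab.symm⟩
  choose a ha b hb hab using hdec
  have hab' : ∀ j i, (a j i : L) + (b j i : L) = if i = j then 1 else 0 := by
    intro j i
    have h := congr_fun (hab j) i
    rw [Pi.add_apply, Pi.single_apply] at h
    rw [← Rat.cast_add, ← h]
    split_ifs <;> simp
  -- the splittings `x = x_P + x_Q`, `y = y_P + y_Q` over `L`, `y_i = m_i x_i`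
  set y : ι → L := fun i => (m i : L) * x i with hy
  have hsplit : ∀ (v : ι → L) (i : ι), v i = (∑ j, v j * (a j i : L)) + ∑ j, v j * (b j i : L) := by
    intro v i
    rw [← Finset.sum_add_distrib]
    simp_rw [← mul_add, hab']
    simp
  -- the three orthogonality relations over `L`
  have hO1 : ∀ j, ∑ i, x i * (a j i : L) = 0 := by
    intro j
    have h := hxP (a j) (ha j)
    simpa only [mul_comm] using h
  have hO2 : ∀ j, ∑ i, (b j i : L) * y i = 0 := fun j => hB (b j) (hQP (b j) (hb j))
  have hO3 : ∀ j k, ∑ i, (a j i : L) * (b k i : L) = 0 := by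
    intro j k
    have h := hPQ (a j) (ha j) (b k) (hb k)
    have h' : ((∑ i, a j i * b k i : ℚ) : L) = 0 := by rw [h, Rat.cast_zero]
    simpa only [Rat.cast_sum, Rat.cast_mul] using h'
  -- two reshuffling identities
  have H1 : ∀ (v w : ι → L) (c : ι → ι → L),
      ∑ i, v i * ∑ k, w k * c k i = ∑ k, w k * ∑ i, v i * c k i := by
    intro v w c
    simp only [Finset.mul_sum]
    rw [Finset.sum_comm]
    exact Finset.sum_congr rfl fun k _ => Finset.sum_congr rfl fun i _ => by ring
  have H2 : ∀ (v w : ι → L) (c : ι → ι → L),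
      ∑ i, (∑ j, w j * c j i) * v i = ∑ j, w j * ∑ i, c j i * v i := by
    intro v w c
    simp only [Finset.mul_sum, Finset.sum_mul]
    rw [Finset.sum_comm]
    exact Finset.sum_congr rfl fun j _ => Finset.sum_congr rfl fun i _ => by ring
  -- their instances (beta-reduced, so that `rw` finds them)
  have H1a : ∀ v w : ι → L, ∑ i, v i * ∑ k, w k * (a k i : L) = ∑ k, w k * ∑ i, v i * (a k i : L) :=
    fun v w => H1 v w fun k i => (a k i : L)
  have H1b : ∀ v w : ι → L, ∑ i, v i * ∑ k, w k * (b k i : L) = ∑ k, w k * ∑ i, v i * (b k i : L) :=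
    fun v w => H1 v w fun k i => (b k i : L)
  have H2a : ∀ v w : ι → L, ∑ i, (∑ j, w j * (a j i : L)) * v i = ∑ j, w j * ∑ i, (a j i : L) * v i :=
    fun v w => H2 v w fun j i => (a j i : L)
  have H2b : ∀ v w : ι → L, ∑ i, (∑ j, w j * (b j i : L)) * v i = ∑ j, w j * ∑ i, (b j i : L) * v i :=
    fun v w => H2 v w fun j i => (b j i : L)
  -- `⟨x, y⟩ = ⟨x, y_P⟩ + ⟨x, y_Q⟩ = 0 + Σ_k y_k ⟨x, b_k⟩`
  have hgoal : ∑ i, (m i : L) * (x i * x i) = ∑ i, x i * y i := by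
    refine Finset.sum_congr rfl fun i _ => ?_
    rw [hy]
    ring
  rw [hgoal]
  have hstep1 : ∑ i, x i * y i = ∑ k, y k * ∑ i, x i * (b k i : L) := by
    calc ∑ i, x i * y i = ∑ i, x i * ((∑ k, y k * (a k i : L)) + ∑ k, y k * (b k i : L)) :=
          Finset.sum_congr rfl fun i _ => by rw [← hsplit y i]
      _ = (∑ i, x i * ∑ k, y k * (a k i : L)) + ∑ i, x i * ∑ k, y k * (b k i : L) := by
          simp only [mul_add, Finset.sum_add_distrib]
      _ = (∑ k, y k * ∑ i, x i * (a k i : L)) + ∑ k, y k * ∑ i, x i * (b k i : L) := by rw [H1a, H1b]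
      _ = ∑ k, y k * ∑ i, x i * (b k i : L) := by simp only [hO1, mul_zero, Finset.sum_const_zero, zero_add]
  -- `⟨x, b_k⟩ = ⟨x_P, b_k⟩ + ⟨x_Q, b_k⟩ = 0 + Σ_j x_j ⟨b_j, b_k⟩`
  have hstep2 : ∀ k, ∑ i, x i * (b k i : L) = ∑ j, x j * ∑ i, (b j i : L) * (b k i : L) := by
    intro k
    calc ∑ i, x i * (b k i : L) = ∑ i, ((∑ j, x j * (a j i : L)) + ∑ j, x j * (b j i : L)) * (b k i : L) :=
          Finset.sum_congr rfl fun i _ => by rw [← hsplit x i]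
      _ = (∑ i, (∑ j, x j * (a j i : L)) * (b k i : L)) + ∑ i, (∑ j, x j * (b j i : L)) * (b k i : L) := by
          simp only [add_mul, Finset.sum_add_distrib]
      _ = (∑ j, x j * ∑ i, (a j i : L) * (b k i : L)) + ∑ j, x j * ∑ i, (b j i : L) * (b k i : L) := by
          rw [H2a, H2b]
      _ = ∑ j, x j * ∑ i, (b j i : L) * (b k i : L) := by simp only [hO3, mul_zero, Finset.sum_const_zero, zero_add]
  -- `Σ_k y_k ⟨b_j, b_k⟩ = ⟨b_j, y_Q⟩ = ⟨b_j, y⟩ − ⟨b_j, y_P⟩ = 0`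
  have hstep3 : ∀ j, ∑ k, y k * ∑ i, (b j i : L) * (b k i : L) = 0 := by
    intro j
    have h : ∑ i, (b j i : L) * y i =
        (∑ k, y k * ∑ i, (b j i : L) * (a k i : L)) + ∑ k, y k * ∑ i, (b j i : L) * (b k i : L) := by
      calc ∑ i, (b j i : L) * y i = ∑ i, (b j i : L) * ((∑ k, y k * (a k i : L)) + ∑ k, y k * (b k i : L)) :=
            Finset.sum_congr rfl fun i _ => by rw [← hsplit y i]
        _ = (∑ i, (b j i : L) * ∑ k, y k * (a k i : L)) + ∑ i, (b j i : L) * ∑ k, y k * (b k i : L) := by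
            simp only [mul_add, Finset.sum_add_distrib]
        _ = _ := by rw [H1a, H1b]
    have h3 : ∀ k, ∑ i, (b j i : L) * (a k i : L) = 0 := fun k => by
      simpa only [mul_comm] using hO3 k j
    simp only [h3, mul_zero, Finset.sum_const_zero, zero_add, hO2 j] at h
    exact h.symm
  rw [hstep1]
  simp_rw [hstep2]
  have H1c : ∑ j, x j * ∑ k, y k * ∑ i, (b j i : L) * (b k i : L) =
      ∑ k, y k * ∑ j, x j * ∑ i, (b j i : L) * (b k i : L) :=
    H1 x y fun k j => ∑ i, (b j i : L) * (b k i : L)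
  rw [← H1c]
  simp only [hstep3, mul_zero, Finset.sum_const_zero]

/-- The complex-number instance of double orthogonality (the form used for the centre of the Hodge Lie algebra).
[cite: Deligne1982HodgeCycles, I §3 Prop. 3.4 and Example 3.7 (c)] -/
theorem sum_mul_mul_self_eq_zero_of_orthogonal_complex (P : Set (ι → ℚ)) (m : ι → ℚ) (x : ι → ℂ)
    (hA : ∀ p ∈ P, ∑ i, (p i : ℂ) * x i = 0)
    (hB : ∀ q : ι → ℚ, (∀ p ∈ P, ∑ i, q i * p i = 0) → ∑ i, (q i : ℂ) * ((m i : ℂ) * x i) = 0) :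
    ∑ i, (m i : ℂ) * (x i * x i) = 0 :=
  sum_mul_mul_self_eq_zero_of_orthogonal P m x hA hB

end Literature.AlgebraicGeometry.Motives

end
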